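import Literature.Probability.RandomPlanarGeometry.SAWPolygonConcatenation
import Literature.Probability.RandomPlanarGeometry.SAWPolygonGrowth
import Mathlib.Algebra.Order.Group.PiLex
import HarnessLib

/-!
# Unrooting self-avoiding polygons: `2N q_N = 2d c_{N-1}(0,e)` (Madras–Slade (3.2.1)) and the
# second inequality of (3.2.8), in every dimension

Topic `Literature/Probability/RandomPlanarGeometry` (continues `SAWPolygonConcatenation.lean`: the
canonical representatives `PolygonConcat.polygonReps d N` of the `N`-step self-avoiding polygons up
to translation and `q_N = PolygonConcat.polygonNumber d N` (Madras–Slade Definition 3.2.2),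
Theorem 3.2.3, `μ_Polygon = PolygonConcat.muPolygon` with (3.2.5) and `μ_Polygon ≤ μ`; and
`SAWPolygonGrowth.lean`: `card_saLoops_succ_eq_two_mul_countAt : #saLoops d (N+1) = 2d · c_N(0,e)`
for every neighbour `e` of the origin, the walk side of (3.2.1)). Source: N. Madras, G. Slade,
*The Self-Avoiding Walk* (Birkhäuser 1993), §3.2, p. 63, eq. (3.2.1): "if `e` is one of the `2d`
nearest neighbours of the origin in `ℤ^d`, then … `2N q_N = 2d c_{N-1}(0,e)` (3.2.1) for every
`N > 2`" — "the number of `N`-step self-avoiding polygons (as we have defined them), modulo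
translation, is … the number of `(N-1)`-step self-avoiding walks `ω` having `‖ω(N-1) - ω(0)‖₁ = 1`,
divided by `2N` … the `2` arises since a walk could traverse the polygon in either of two
directions"; and Corollary 3.2.5, p. 67, (3.2.8), second inequality:
"`c_{2M+1}(0,e) ≤ (2(M+1)(d-1)/d) μ^{2M+2}` … follows from (3.2.1), (3.2.5), and the obvious bound
`μ_Polygon ≤ μ`" (left as "TODO(general form)" in `SAWPolygonGrowth.lean`).

## What is proved (namespace `Literature.Probability.RandomPlanarGeometry.SAW.Zd.PolygonConcat`)

* **`card_saLoops_eq (hN : 3 ≤ N) : #saLoops d N = 2N · q_N`** — every rooted oriented loop of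
  `saLoops d N` is obtained exactly once by re-rooting (`rotLoop`, `N` choices of the root) one of
  the two orientations (`orient`) of a canonical representative (free action of root shift × reversal;
  the lexicographically smallest site fixes the shift, the canonical orientation the reversal);
* **`MadrasSlade1993_eq321`** (3.2.1) as printed: `2N q_N = 2d c_{N-1}(0,e)` for `N ≥ 3` and every
  neighbour `e` of `0`;
* **`MadrasSlade1993_eq328_right`**: `c_{2M+1}(0,e) ≤ (2(M+1)(d-1)/d) μ^{2M+2}` for `M ≥ 1`, `d ≥ 2`
  (the second inequality of (3.2.8), with the printed constant).

Helpers are `private`; `rotLoop`, `orient`, `unroot` are plumbing.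
-/

noncomputable section

open Finset Filter Topology Function Literature.Probability.LatticeModels Literature.Probability.Percolation SimpleGraph
open scoped BigOperators

namespace Literature.Probability.RandomPlanarGeometry.SAW.Zd

namespace PolygonConcat

variable {d : ℕ}

/-- Membership in `saLoops`, unfolded (re-derived: the concatenation file keeps it private). [folklore] -/
private theorem mem_saLoops'' {N : ℕ} {ω : ℕ → Site d} :
    ω ∈ saLoops d N ↔ ω 0 = 0 ∧ (∀ i, N ≤ i → ω i = ω N) ∧
      (∀ i < N, (zdGraph d).Adj (ω i) (ω (i + 1))) ∧ ω N = 0 ∧ Set.InjOn ω {i | i < N} := by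
  classical
  rw [mem_saLoops, nnWalks, Finset.mem_filter]
  constructor
  · rintro ⟨⟨hfr, h0, hadj⟩, hN, hinj⟩
    rw [frozenFns, Finset.mem_image] at hfr
    obtain ⟨f, -, hf⟩ := hfr
    refine ⟨h0, fun i hi => ?_, hadj, hN, hinj⟩
    rw [← hf]; simp only [min_eq_right hi, min_self]
  · rintro ⟨h0, hfr, hadj, hN, hinj⟩
    refine ⟨⟨?_, h0, hadj⟩, hN, hinj⟩
    rw [frozenFns, Finset.mem_image]
    refine ⟨fun i => ω i, ?_, ?_⟩
    · rw [Fintype.mem_piFinset]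
      intro i
      rw [mem_box]
      intro j
      have h := abs_le.1 (abs_apply_le_of_adj h0 hadj i (by omega) j)
      constructor <;> omega
    · funext i
      rcases le_or_gt i N with hi | hi
      · simp [min_eq_left hi]
      · simp only [min_eq_right hi.le]
        exact (hfr i hi.le).symm

/-- In a loop the values at times `1, …, N-1` differ from `0 = ω(0) = ω(N)`; together with
injectivity on `[0, N)` this gives injectivity on `(0, N]` as well. [folklore] -/
private theorem loop_injOn_Ioc {N : ℕ} {ω : ℕ → Site d} (hω : ω ∈ saLoops d N) : Set.InjOn ω {i | 0 < i ∧ i ≤ N} := by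
  obtain ⟨h0, -, -, hN, hinj⟩ := mem_saLoops''.1 hω
  intro i hi j hj hij
  simp only [Set.mem_setOf_eq] at hi hj
  rcases lt_or_eq_of_le hi.2 with hi' | rfl
  · rcases lt_or_eq_of_le hj.2 with hj' | rfl
    · exact hinj hi' hj' hij
    · exfalso
      rw [hN, ← h0] at hij
      have := hinj hi' (show 0 < j from hj.1) hij
      omega
  · rcases lt_or_eq_of_le hj.2 with hj' | hj''
    · exfalso
      rw [hN, ← h0] at hij
      have := hinj (show 0 < i from hi.1) hj' hij
      omega
    · exact hj''.symm

/-- Membership in `canonLoops`. [folklore] -/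
private theorem mem_canonLoops {N : ℕ} {ω : ℕ → Site d} :
    ω ∈ canonLoops d N ↔ ω ∈ saLoops d N ∧ ∀ i < N, toLex (0 : Site d) ≤ toLex (ω i) := by
  classical
  rw [canonLoops, Finset.mem_filter]

/-- All sites (at all times) of a canonical loop are lexicographically `≥ 0`. [folklore] -/
private theorem toLex_nonneg_of_mem_canonLoops {N : ℕ} {ω : ℕ → Site d} (hω : ω ∈ canonLoops d N) (i : ℕ) :
    toLex (0 : Site d) ≤ toLex (ω i) := by
  obtain ⟨hs, hlex⟩ := mem_canonLoops.1 hω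
  obtain ⟨h0, hfr, -, hN, -⟩ := mem_saLoops''.1 hs
  rcases lt_or_ge i N with hi | hi
  · exact hlex i hi
  · rw [hfr i hi, hN]

/-- Values of the reversal. [folklore] -/
private theorem revLoop_of_le {N s : ℕ} {ω : ℕ → Site d} (hs : s ≤ N) : revLoop N ω s = ω (N - s) := by
  rw [revLoop, min_eq_left hs]

/-- The reversal of a loop is a loop. [folklore] -/
private theorem revLoop_mem_saLoops {N : ℕ} {ω : ℕ → Site d} (hω : ω ∈ saLoops d N) : revLoop N ω ∈ saLoops d N := by
  obtain ⟨h0, hfr, hadj, hN, hinj⟩ := mem_saLoops''.1 hω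
  have hinj' := loop_injOn_Ioc hω
  refine mem_saLoops''.2 ⟨by rw [revLoop_of_le (Nat.zero_le _), Nat.sub_zero, hN], fun i hi => ?_,
    fun i hi => ?_, by rw [revLoop_of_le le_rfl, Nat.sub_self, h0], fun i hi j hj hij => ?_⟩
  · rw [revLoop, revLoop, min_eq_right hi, min_self]
  · rw [revLoop_of_le hi.le, revLoop_of_le (Nat.succ_le_of_lt hi)]
    have := hadj (N - (i + 1)) (by omega)
    rw [show N - (i + 1) + 1 = N - i by omega] at this
    exact this.symm
  · simp only [Set.mem_setOf_eq] at hi hj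
    rw [revLoop_of_le hi.le, revLoop_of_le hj.le] at hij
    have := hinj' ⟨by omega, Nat.sub_le N i⟩ ⟨by omega, Nat.sub_le N j⟩ hij
    omega

/-- Reversal is an involution on loops. [folklore] -/
private theorem revLoop_revLoop {N : ℕ} {ω : ℕ → Site d} (hω : ω ∈ saLoops d N) : revLoop N (revLoop N ω) = ω := by
  obtain ⟨h0, hfr, -, hN, -⟩ := mem_saLoops''.1 hω
  funext s
  rcases le_or_gt s N with hs | hs
  · rw [revLoop_of_le hs, revLoop_of_le (Nat.sub_le N s), Nat.sub_sub_self hs]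
  · rw [revLoop, min_eq_right hs.le, Nat.sub_self, revLoop_of_le (Nat.zero_le _), Nat.sub_zero, hN,
      hfr s hs.le, hN]

/-- Reversal preserves `Q[N]`. [folklore] -/
private theorem revLoop_mem_canonLoops {N : ℕ} {ω : ℕ → Site d} (hω : ω ∈ canonLoops d N) :
    revLoop N ω ∈ canonLoops d N := by
  obtain ⟨hs, hlex⟩ := mem_canonLoops.1 hω
  refine mem_canonLoops.2 ⟨revLoop_mem_saLoops hs, fun i hi => ?_⟩
  rw [revLoop_of_le hi.le]
  exact toLex_nonneg_of_mem_canonLoops hω _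

/-- `μ_Polygon > 0`. [folklore] -/
private theorem muPolygon_pos' [NeZero d] (hd : 2 ≤ d) : 0 < muPolygon d hd := Real.exp_pos _

/-! ### Unrooting: `#saLoops(N) = 2N · q_N` (the counting behind (3.2.1)) -/

section Unroot

variable {N : ℕ} {ω τ : ℕ → Site d}

/-- The lexicographic order is translation invariant (strict form). [folklore] -/
private theorem toLex_sub_lt_sub {x y : Site d} (h : toLex x < toLex y) (z : Site d) : toLex (x - z) < toLex (y - z) := by
  rw [toLex_sub, toLex_sub]; exact sub_lt_sub_right h _

/-- The lexicographic order is translation invariant. [folklore] -/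
private theorem toLex_sub_le_sub {x y : Site d} (h : toLex x ≤ toLex y) (z : Site d) : toLex (x - z) ≤ toLex (y - z) := by
  rcases lt_or_eq_of_le h with h | h
  · exact (toLex_sub_lt_sub h z).le
  · rw [toLex_inj.1 h]

/-- Re-rooting a loop at time `r`: `s ↦ ω((r + s) mod N) - ω(r)` (frozen at `0` after time `N`). [folklore] -/
def rotLoop (N r : ℕ) (ω : ℕ → Site d) : ℕ → Site d :=
  fun s => if s ≤ N then ω ((r + s) % N) - ω r else 0

/-- Values of the re-rooted loop. [folklore] -/
private theorem rotLoop_of_le {r s : ℕ} (hs : s ≤ N) : rotLoop N r ω s = ω ((r + s) % N) - ω r := if_pos hs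

/-- Re-rooting preserves loops. [folklore] -/
private theorem rotLoop_mem_saLoops (hω : ω ∈ saLoops d N) {r : ℕ} (hr : r < N) : rotLoop N r ω ∈ saLoops d N := by
  obtain ⟨h0, hfr, hadj, hN, hinj⟩ := mem_saLoops''.1 hω
  have hNpos : 0 < N := by omega
  refine mem_saLoops''.2 ⟨?_, fun s hs => ?_, fun s hs => ?_, ?_, fun s hs u hu hsu => ?_⟩
  · rw [rotLoop_of_le (Nat.zero_le _), add_zero, Nat.mod_eq_of_lt hr, sub_self]
  · rcases eq_or_lt_of_le hs with h | h
    · rw [h]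
    · rw [rotLoop, if_neg (by omega), rotLoop, if_pos le_rfl, Nat.add_mod_right, Nat.mod_eq_of_lt hr, sub_self]
  · rw [rotLoop_of_le hs.le, rotLoop_of_le (Nat.succ_le_of_lt hs), zdGraph_adj_sub_right]
    -- consecutive residues
    have key : (zdGraph d).Adj (ω ((r + s) % N)) (ω (((r + s) % N) + 1)) := hadj _ (Nat.mod_lt _ hNpos)
    have hdm := Nat.div_add_mod (r + s) N
    rcases Nat.lt_or_ge ((r + s) % N + 1) N with h1 | h1
    · have e0 : r + (s + 1) = ((r + s) % N + 1) + N * ((r + s) / N) := by linarith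
      have e : (r + (s + 1)) % N = (r + s) % N + 1 := by
        rw [e0, Nat.add_mul_mod_self_left, Nat.mod_eq_of_lt h1]
      rw [e]; exact key
    · have e1 : (r + s) % N + 1 = N := by have := Nat.mod_lt (r + s) hNpos; omega
      have e0 : r + (s + 1) = N * ((r + s) / N + 1) := by
        have : r + (s + 1) = N * ((r + s) / N) + ((r + s) % N + 1) := by linarith
        rw [this, e1]; ring
      have e2 : (r + (s + 1)) % N = 0 := by rw [e0, Nat.mul_mod_right]
      rw [e2, h0]; rw [e1, hN] at key; exact key
  · rw [rotLoop_of_le le_rfl, Nat.add_mod_right, Nat.mod_eq_of_lt hr, sub_self]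
  · simp only [Set.mem_setOf_eq] at hs hu
    rw [rotLoop_of_le hs.le, rotLoop_of_le hu.le, sub_left_inj] at hsu
    have e : (r + s) % N = (r + u) % N := hinj (Nat.mod_lt _ hNpos) (Nat.mod_lt _ hNpos) hsu
    exact Nat.ModEq.eq_of_lt_of_lt (Nat.ModEq.add_left_cancel' r e) hs hu

/-- `x ≼ y ↔ 0 ≼ y - x`. [folklore] -/
private theorem toLex_le_iff_sub_nonneg {x y : Site d} : toLex x ≤ toLex y ↔ toLex (0 : Site d) ≤ toLex (y - x) := by
  rw [toLex_sub, toLex_zero, sub_nonneg]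

/-- Beyond time `N` the re-rooted loop is `0`. [folklore] -/
private theorem rotLoop_of_gt {r s : ℕ} (hs : N < s) : rotLoop N r ω s = 0 := if_neg (not_le.2 hs)

/-- Re-rooting twice. [folklore] -/
private theorem rotLoop_rotLoop {r r' : ℕ} (hr' : r' < N) :
    rotLoop N r' (rotLoop N r τ) = rotLoop N ((r + r') % N) τ := by
  have hNpos : 0 < N := by omega
  funext s
  rcases le_or_gt s N with hs | hs
  · rw [rotLoop_of_le hs, rotLoop_of_le hs, rotLoop_of_le (Nat.mod_lt _ hNpos).le, rotLoop_of_le hr'.le]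
    have e1 : (r + (r' + s) % N) % N = (r + r' + s) % N := by
      rw [Nat.add_mod, Nat.mod_mod, ← Nat.add_mod, add_assoc]
    have e2 : ((r + r') % N + s) % N = (r + r' + s) % N := by
      rw [Nat.add_mod, Nat.mod_mod, ← Nat.add_mod]
    rw [e1, e2]; abel
  · rw [rotLoop_of_gt hs, rotLoop_of_gt hs]

/-- Re-rooting at time `0` does nothing. [folklore] -/
private theorem rotLoop_zero (hτ : τ ∈ saLoops d N) (hN : 1 ≤ N) : rotLoop N 0 τ = τ := by
  obtain ⟨h0, hfr, -, hNe, -⟩ := mem_saLoops''.1 hτ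
  funext s
  rcases lt_trichotomy s N with hs | rfl | hs
  · rw [rotLoop_of_le hs.le, zero_add, Nat.mod_eq_of_lt hs, h0, sub_zero]
  · rw [rotLoop_of_le le_rfl, zero_add, Nat.mod_self, h0, sub_zero, hNe]
  · rw [rotLoop_of_gt hs, hfr s hs.le, hNe]

/-- If re-rooting at `a` puts the lexicographically smallest site at the root, then `τ(a)` is the
smallest site of `τ`. [folklore] -/
private theorem toLex_le_of_rotLoop_mem_canonLoops (hN : 1 ≤ N) {a : ℕ} (ha : a < N)
    (h : rotLoop N a τ ∈ canonLoops d N) (s : ℕ) (hs : s < N) : toLex (τ a) ≤ toLex (τ s) := by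
  have hNpos : 0 < N := by omega
  obtain ⟨-, hlex⟩ := mem_canonLoops.1 h
  -- the time `u` with `(a + u) % N = s`
  set u := (s + N - a) % N with hu
  have huN : u < N := Nat.mod_lt _ hNpos
  have e : (a + u) % N = s := by
    rw [hu, Nat.add_mod, Nat.mod_mod, ← Nat.add_mod, show a + (s + N - a) = s + N by omega,
      Nat.add_mod_right, Nat.mod_eq_of_lt hs]
  have := hlex u huN
  rw [rotLoop_of_le huN.le, e] at this
  exact toLex_le_iff_sub_nonneg.2 this

/-- Two re-rootings that are both canonical coincide. [folklore] -/
private theorem rot_eq_of_canon (hτ : τ ∈ saLoops d N) (hN : 1 ≤ N) {a a' : ℕ} (ha : a < N) (ha' : a' < N)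
    (h : rotLoop N a τ ∈ canonLoops d N) (h' : rotLoop N a' τ ∈ canonLoops d N) : a = a' := by
  have h1 := toLex_le_of_rotLoop_mem_canonLoops hN ha h a' ha'
  have h2 := toLex_le_of_rotLoop_mem_canonLoops hN ha' h' a ha
  have := toLex_inj.1 (le_antisymm h1 h2)
  exact (mem_saLoops''.1 hτ).2.2.2.2 ha ha' this

/-- A loop has a time at which it is lexicographically smallest. [folklore] -/
private theorem exists_lexmin_time (hN : 1 ≤ N) (τ : ℕ → Site d) :
    ∃ r, r < N ∧ ∀ s < N, toLex (τ r) ≤ toLex (τ s) := by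
  obtain ⟨r, hr, h⟩ := Finset.exists_min_image (Finset.range N) (fun s => toLex (τ s))
    ⟨0, Finset.mem_range.2 (by omega)⟩
  exact ⟨r, Finset.mem_range.1 hr, fun s hs => h s (Finset.mem_range.2 hs)⟩

/-- Re-rooting at a lexicographically smallest site gives a canonical loop. [folklore] -/
private theorem rotLoop_mem_canonLoops (hτ : τ ∈ saLoops d N) {r : ℕ} (hr : r < N)
    (hmin : ∀ s < N, toLex (τ r) ≤ toLex (τ s)) : rotLoop N r τ ∈ canonLoops d N := by
  have hNpos : 0 < N := by omega
  refine mem_canonLoops.2 ⟨rotLoop_mem_saLoops hτ hr, fun s hs => ?_⟩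
  rw [rotLoop_of_le hs.le]
  exact toLex_le_iff_sub_nonneg.1 (hmin _ (Nat.mod_lt _ hNpos))

open Classical in
/-- Orient a canonical representative: reverse it or not. [folklore] -/
def orient (N : ℕ) (b : Bool) (ω : ℕ → Site d) : ℕ → Site d := if b then revLoop N ω else ω

/-- The unrooting map `(ω, r, b) ↦` re-root at `r` the `b`-orientation of `ω`. [folklore] -/
def unroot (N : ℕ) (x : (ℕ → Site d) × ℕ × Bool) : ℕ → Site d := rotLoop N x.2.1 (orient N x.2.2 x.1)

/-- The orientation of a canonical loop is a canonical loop. [folklore] -/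
private theorem orient_mem_canonLoops (hω : ω ∈ canonLoops d N) (b : Bool) : orient N b ω ∈ canonLoops d N := by
  unfold orient; split_ifs
  · exact revLoop_mem_canonLoops hω
  · exact hω

/-- **`#saLoops(N) = 2N q_N`** (`N ≥ 3`): every rooted oriented loop is obtained exactly once by
re-rooting (`N` choices) one of the two orientations of a canonical representative — the counting
behind "(3.2.1) `2N q_N = 2d c_{N-1}(0,e)`" together with the tree's
`card_saLoops_succ_eq_two_mul_countAt`. [cite: MadrasSlade1993, §3.2, eq. (3.2.1)] -/
theorem card_saLoops_eq (hN : 3 ≤ N) : (saLoops d N).card = 2 * N * polygonNumber d N := by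
  classical
  set D := polygonReps d N ×ˢ (Finset.range N ×ˢ (Finset.univ : Finset Bool)) with hD
  have hcardD : D.card = 2 * N * polygonNumber d N := by
    rw [hD, Finset.card_product, Finset.card_product, Finset.card_range, Finset.card_univ,
      Fintype.card_bool, polygonNumber]; ring
  -- the unrooting map is injective on `D`
  have hreps : ∀ {ω}, ω ∈ polygonReps d N → ω ∈ canonLoops d N ∧ toLex (ω 1) < toLex (ω (N - 1)) :=
    fun {ω} h => Finset.mem_filter.1 h
  have hinj : Set.InjOn (unroot (d := d) N) ↑D := by
    rintro ⟨ω, r, b⟩ hx ⟨ω', r', b'⟩ hx' hxx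
    simp only [hD, Finset.coe_product, Set.mem_prod, Finset.mem_coe, Finset.mem_range, Finset.coe_univ,
      Set.mem_univ, and_true] at hx hx'
    obtain ⟨hω, hlt⟩ := hreps hx.1
    obtain ⟨hω', hlt'⟩ := hreps hx'.1
    have hσ := orient_mem_canonLoops hω b
    have hσ' := orient_mem_canonLoops hω' b'
    have hσs := (mem_canonLoops.1 hσ).1
    have hσs' := (mem_canonLoops.1 hσ').1
    simp only [unroot] at hxx
    -- re-root back: both re-rootings of `τ := unroot …` at `(N - r) % N`, `(N - r') % N` are canonical
    have hNpos : 0 < N := by omega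
    set τ := rotLoop N r (orient N b ω) with hτdef
    have hτ : τ ∈ saLoops d N := rotLoop_mem_saLoops hσs hx.2
    have back : ∀ {r : ℕ} {σ : ℕ → Site d}, r < N → σ ∈ saLoops d N →
        rotLoop N ((N - r) % N) (rotLoop N r σ) = σ := fun {r} {σ} hr hs => by
      rw [rotLoop_rotLoop (Nat.mod_lt _ hNpos),
        show (r + (N - r) % N) % N = 0 by
          rw [Nat.add_mod, Nat.mod_mod, ← Nat.add_mod, show r + (N - r) = N by omega, Nat.mod_self],
        rotLoop_zero hs (by omega)]
    have e1 : rotLoop N ((N - r) % N) τ = orient N b ω := back hx.2 hσs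
    have e2 : rotLoop N ((N - r') % N) τ = orient N b' ω' := by rw [hxx]; exact back hx'.2 hσs'
    have hrr : (N - r) % N = (N - r') % N :=
      rot_eq_of_canon hτ (by omega) (Nat.mod_lt _ hNpos) (Nat.mod_lt _ hNpos) (e1 ▸ hσ) (e2 ▸ hσ')
    have hr_eq : r = r' := by
      have h1 := hx.2; have h2 := hx'.2
      rcases Nat.eq_zero_or_pos r with hr0 | hr0 <;> rcases Nat.eq_zero_or_pos r' with hr0' | hr0'
      · omega
      · rw [hr0, Nat.sub_zero, Nat.mod_self, Nat.mod_eq_of_lt (by omega : N - r' < N)] at hrr; omega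
      · rw [hr0', Nat.sub_zero, Nat.mod_self, Nat.mod_eq_of_lt (by omega : N - r < N)] at hrr; omega
      · rw [Nat.mod_eq_of_lt (by omega : N - r < N), Nat.mod_eq_of_lt (by omega : N - r' < N)] at hrr; omega
    subst hr_eq
    have hoo : orient N b ω = orient N b' ω' := by rw [← e1, ← e2]
    -- orientations agree
    have hωs := (mem_canonLoops.1 hω).1
    have hωs' := (mem_canonLoops.1 hω').1
    have key : b = b' ∧ ω = ω' := by
      cases b <;> cases b'
      · exact ⟨rfl, by simpa [orient] using hoo⟩
      · exfalso
        have hoo' : ω = revLoop N ω' := by simpa [orient] using hoo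
        have h1 : ω 1 = ω' (N - 1) := by rw [hoo', revLoop_of_le (by omega)]
        have h2 : ω (N - 1) = ω' 1 := by rw [hoo', revLoop_of_le (by omega), show N - (N - 1) = 1 by omega]
        rw [h1, h2] at hlt
        exact lt_asymm hlt hlt'
      · exfalso
        have hoo' : revLoop N ω = ω' := by simpa [orient] using hoo
        have h1 : ω' 1 = ω (N - 1) := by rw [← hoo', revLoop_of_le (by omega)]
        have h2 : ω' (N - 1) = ω 1 := by rw [← hoo', revLoop_of_le (by omega), show N - (N - 1) = 1 by omega]
        rw [h1, h2] at hlt'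
        exact lt_asymm hlt hlt'
      · have hoo' : revLoop N ω = revLoop N ω' := by simpa [orient] using hoo
        exact ⟨rfl, by rw [← revLoop_revLoop hωs, ← revLoop_revLoop hωs', hoo']⟩
    rw [key.2, key.1]
  -- and its image is all of `saLoops d N`
  have himg : D.image (unroot (d := d) N) = saLoops d N := by
    apply Finset.Subset.antisymm
    · intro τ hτ
      obtain ⟨⟨ω, r, b⟩, hx, rfl⟩ := Finset.mem_image.1 hτ
      simp only [hD, Finset.mem_product, Finset.mem_range, Finset.mem_univ, and_true] at hx
      exact rotLoop_mem_saLoops (mem_canonLoops.1 (orient_mem_canonLoops (hreps hx.1).1 b)).1 hx.2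
    · intro τ hτ
      have hNpos : 0 < N := by omega
      obtain ⟨r₀, hr₀, hmin⟩ := exists_lexmin_time (N := N) (by omega) τ
      have hσ := rotLoop_mem_canonLoops hτ hr₀ hmin
      set σ := rotLoop N r₀ τ with hσdef
      have hσs := (mem_canonLoops.1 hσ).1
      have hne : toLex (σ 1) ≠ toLex (σ (N - 1)) := fun h => by
        have := (mem_saLoops''.1 hσs).2.2.2.2 (show 1 < N by omega) (show N - 1 < N by omega) (toLex_inj.1 h)
        omega
      -- choose the orientation
      obtain ⟨ω₀, b, hω₀, hob⟩ : ∃ ω₀ b, ω₀ ∈ polygonReps d N ∧ orient N b ω₀ = σ := by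
        rcases lt_or_gt_of_ne hne with h | h
        · exact ⟨σ, false, Finset.mem_filter.2 ⟨hσ, h⟩, by simp [orient]⟩
        · refine ⟨revLoop N σ, true, Finset.mem_filter.2 ⟨revLoop_mem_canonLoops hσ, ?_⟩, ?_⟩
          · rw [revLoop_of_le (by omega), revLoop_of_le (by omega), show N - (N - 1) = 1 by omega]; exact h
          · simp [orient, revLoop_revLoop hσs]
      refine Finset.mem_image.2 ⟨(ω₀, (N - r₀) % N, b), ?_, ?_⟩
      · simp only [hD, Finset.mem_product, Finset.mem_range, Finset.mem_univ, and_true]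
        exact ⟨hω₀, Nat.mod_lt _ hNpos⟩
      · simp only [unroot, hob, hσdef]
        rw [rotLoop_rotLoop (Nat.mod_lt _ hNpos),
          show (r₀ + (N - r₀) % N) % N = 0 by
            rw [Nat.add_mod, Nat.mod_mod, ← Nat.add_mod, show r₀ + (N - r₀) = N by omega, Nat.mod_self],
          rotLoop_zero hτ (by omega)]
  rw [← himg, Finset.card_image_of_injOn hinj, hcardD]


end Unroot

/-- **Madras–Slade (3.2.1), as printed**: `2N q_N = 2d c_{N-1}(0,e)` for every `N ≥ 3` and every
neighbour `e` of the origin. [cite: MadrasSlade1993, §3.2, eq. (3.2.1)] -/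
theorem MadrasSlade1993_eq321 [NeZero d] {N : ℕ} (hN : 3 ≤ N) {e : Site d} (he : (zdGraph d).Adj e 0) :
    2 * N * polygonNumber d N = 2 * d * countAt d (N - 1) e := by
  rw [← card_saLoops_eq hN]
  have := card_saLoops_succ_eq_two_mul_countAt (d := d) (N - 1) he
  rwa [show N - 1 + 1 = N by omega] at this

/-- **Madras–Slade (3.2.8), second inequality, as printed**: for `d ≥ 2`, `M ≥ 1` and every neighbour
`e` of the origin, `c_{2M+1}(0,e) ≤ (2(M+1)(d-1)/d) μ^{2M+2}` — from (3.2.1), (3.2.5) and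
`μ_Polygon ≤ μ`. [cite: MadrasSlade1993, Corollary 3.2.5, eq. (3.2.8)] -/
theorem MadrasSlade1993_eq328_right [NeZero d] (hd : 2 ≤ d) {M : ℕ} (hM : 1 ≤ M) {e : Site d}
    (he : (zdGraph d).Adj e 0) :
    (countAt d (2 * M + 1) e : ℝ) ≤
      2 * ((M : ℝ) + 1) * ((d : ℝ) - 1) / d * connectiveConstant d ^ (2 * M + 2) := by
  have h321 := MadrasSlade1993_eq321 (d := d) (N := 2 * M + 2) (by omega) he
  rw [show 2 * M + 2 - 1 = 2 * M + 1 by omega] at h321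
  have h325 := polygonNumber_le_muPolygon_pow hd (n := M + 1) (by omega)
  rw [show 2 * (M + 1) = 2 * M + 2 by ring] at h325
  have hμP := muPolygon_le_connectiveConstant hd
  have hμP0 := (muPolygon_pos' hd).le
  have hpow : muPolygon d hd ^ (2 * M + 2) ≤ connectiveConstant d ^ (2 * M + 2) :=
    pow_le_pow_left₀ hμP0 hμP _
  have hd0 : (0 : ℝ) < d := by exact_mod_cast (show 0 < d by omega)
  have hd1 : (0 : ℝ) ≤ (d : ℝ) - 1 := by
    have : (2 : ℝ) ≤ d := by exact_mod_cast hd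
    linarith
  -- `2(2M+2) q = 2 d c`
  have hq : (2 * (2 * M + 2) : ℝ) * polygonNumber d (2 * M + 2) = 2 * d * countAt d (2 * M + 1) e := by
    exact_mod_cast h321
  have hc : (countAt d (2 * M + 1) e : ℝ) = (2 * M + 2) * polygonNumber d (2 * M + 2) / d := by
    field_simp
    linarith
  rw [hc, div_le_iff₀ hd0]
  have h2 : (2 * (M : ℝ) + 2) * polygonNumber d (2 * M + 2) ≤
      (2 * (M : ℝ) + 2) * (((d : ℝ) - 1) * connectiveConstant d ^ (2 * M + 2)) :=
    mul_le_mul_of_nonneg_left (h325.trans (mul_le_mul_of_nonneg_left hpow hd1)) (by positivity)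
  calc (2 * (M : ℝ) + 2) * polygonNumber d (2 * M + 2)
      ≤ (2 * (M : ℝ) + 2) * (((d : ℝ) - 1) * connectiveConstant d ^ (2 * M + 2)) := h2
    _ = 2 * ((M : ℝ) + 1) * ((d : ℝ) - 1) / d * connectiveConstant d ^ (2 * M + 2) * d := by
        field_simp

/-! ### The unrooting bijection, exposed (for sublattice counts such as the honeycomb / brick-wall lattice)

The proof of `card_saLoops_eq` keeps the bijection `unroot : polygonReps × [0,N) × Bool ≃ saLoops` local.  The lane
«pcv-sawmu» (honeycomb polygons up to translation, `HexSAWPolygonNumber.lean`) needs it BY NAME: membership, the value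
formula, injectivity and surjectivity, and the elementary facts about `rotLoop` / `revLoop` / `orient` that go with them.
Everything below re-derives local steps of the proof above as public statements; no statement above is touched. -/

section UnrootAPI

variable {N : ℕ} {ω τ : ℕ → Site d}

/-- Membership in `saLoops`, unfolded (public form). [cite: MadrasSlade1993, §3.2 (rooted oriented polygons)] -/
theorem mem_saLoops_iff {N : ℕ} {ω : ℕ → Site d} :
    ω ∈ saLoops d N ↔ ω 0 = 0 ∧ (∀ i, N ≤ i → ω i = ω N) ∧
      (∀ i < N, (zdGraph d).Adj (ω i) (ω (i + 1))) ∧ ω N = 0 ∧ Set.InjOn ω {i | i < N} :=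
  mem_saLoops''

/-- Values of the re-rooted loop (public form). [cite: MadrasSlade1993, §3.2, eq. (3.2.1) (re-rooting)] -/
theorem rotLoop_apply_of_le {r s : ℕ} (hs : s ≤ N) : rotLoop N r ω s = ω ((r + s) % N) - ω r := rotLoop_of_le hs

/-- Re-rooting preserves loops (public form). [cite: MadrasSlade1993, §3.2, eq. (3.2.1) (re-rooting)] -/
theorem rotLoop_mem_saLoops' (hω : ω ∈ saLoops d N) {r : ℕ} (hr : r < N) : rotLoop N r ω ∈ saLoops d N :=
  rotLoop_mem_saLoops hω hr

/-- Values of the reversed loop (public form). [cite: MadrasSlade1993, §3.2, eq. (3.2.1) ("either of two directions")] -/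
theorem revLoop_apply_of_le {N s : ℕ} {ω : ℕ → Site d} (hs : s ≤ N) : revLoop N ω s = ω (N - s) := revLoop_of_le hs

/-- The reversal of a loop is a loop (public form). [cite: MadrasSlade1993, §3.2, eq. (3.2.1) ("either of two directions")] -/
theorem revLoop_mem_saLoops' {N : ℕ} {ω : ℕ → Site d} (hω : ω ∈ saLoops d N) : revLoop N ω ∈ saLoops d N :=
  revLoop_mem_saLoops hω

/-- `orient N false = id`, `orient N true = revLoop N`. [cite: MadrasSlade1993, §3.2, eq. (3.2.1)] -/
theorem orient_eq (N : ℕ) (b : Bool) (ω : ℕ → Site d) : orient N b ω = if b then revLoop N ω else ω := rfl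

/-- Orienting a loop gives a loop. [cite: MadrasSlade1993, §3.2, eq. (3.2.1)] -/
theorem orient_mem_saLoops (hω : ω ∈ saLoops d N) (b : Bool) : orient N b ω ∈ saLoops d N := by
  rw [orient_eq]; split_ifs
  · exact revLoop_mem_saLoops hω
  · exact hω

/-- Canonical representatives are loops rooted at `0`. [cite: MadrasSlade1993, Definition 3.2.2] -/
theorem mem_saLoops_of_mem_polygonReps (h : ω ∈ polygonReps d N) : ω ∈ saLoops d N :=
  (mem_canonLoops.1 (Finset.mem_filter.1 h).1).1

/-- The domain of the unrooting map: representative, root shift, orientation. [cite: MadrasSlade1993, §3.2, eq. (3.2.1)] -/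
def unrootDom (d N : ℕ) : Finset ((ℕ → Site d) × ℕ × Bool) :=
  polygonReps d N ×ˢ (Finset.range N ×ˢ (Finset.univ : Finset Bool))

/-- Membership in the domain. [cite: MadrasSlade1993, §3.2, eq. (3.2.1)] -/
theorem mem_unrootDom {x : (ℕ → Site d) × ℕ × Bool} :
    x ∈ unrootDom d N ↔ x.1 ∈ polygonReps d N ∧ x.2.1 < N := by
  simp [unrootDom, Finset.mem_product]

/-- `#unrootDom = 2N · q_N`. [cite: MadrasSlade1993, §3.2, eq. (3.2.1)] -/
theorem card_unrootDom : (unrootDom d N).card = 2 * N * polygonNumber d N := by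
  rw [unrootDom, Finset.card_product, Finset.card_product, Finset.card_range, Finset.card_univ,
    Fintype.card_bool, polygonNumber]; ring

/-- The value formula of the unrooting map. [cite: MadrasSlade1993, §3.2, eq. (3.2.1)] -/
theorem unroot_apply_of_le {x : (ℕ → Site d) × ℕ × Bool} {s : ℕ} (hs : s ≤ N) :
    unroot N x s = orient N x.2.2 x.1 ((x.2.1 + s) % N) - orient N x.2.2 x.1 x.2.1 := by
  simp only [unroot]; exact rotLoop_of_le hs

/-- The unrooting map lands in `saLoops`. [cite: MadrasSlade1993, §3.2, eq. (3.2.1)] -/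
theorem unroot_mem_saLoops {x : (ℕ → Site d) × ℕ × Bool} (hx : x ∈ unrootDom d N) : unroot N x ∈ saLoops d N := by
  obtain ⟨hP, hr⟩ := mem_unrootDom.1 hx
  exact rotLoop_mem_saLoops (orient_mem_saLoops (mem_saLoops_of_mem_polygonReps hP) _) hr

/-- **The unrooting map is injective** on `polygonReps × [0,N) × Bool` (`N ≥ 3`): the root shift is recovered as the unique
re-rooting that is canonical, the orientation by `ω(1) ≺ ω(N-1)`. [cite: MadrasSlade1993, §3.2, eq. (3.2.1)] -/
theorem unroot_injOn (hN : 3 ≤ N) : Set.InjOn (unroot (d := d) N) ↑(unrootDom d N) := by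
  classical
  have hreps : ∀ {ω}, ω ∈ polygonReps d N → ω ∈ canonLoops d N ∧ toLex (ω 1) < toLex (ω (N - 1)) :=
    fun {ω} h => Finset.mem_filter.1 h
  rintro ⟨ω, r, b⟩ hx ⟨ω', r', b'⟩ hx' hxx
  simp only [unrootDom, Finset.coe_product, Set.mem_prod, Finset.mem_coe, Finset.mem_range, Finset.coe_univ,
    Set.mem_univ, and_true] at hx hx'
  obtain ⟨hω, hlt⟩ := hreps hx.1
  obtain ⟨hω', hlt'⟩ := hreps hx'.1
  have hσ := orient_mem_canonLoops hω b
  have hσ' := orient_mem_canonLoops hω' b'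
  have hσs := (mem_canonLoops.1 hσ).1
  have hσs' := (mem_canonLoops.1 hσ').1
  simp only [unroot] at hxx
  have hNpos : 0 < N := by omega
  set τ := rotLoop N r (orient N b ω) with hτdef
  have hτ : τ ∈ saLoops d N := rotLoop_mem_saLoops hσs hx.2
  have back : ∀ {r : ℕ} {σ : ℕ → Site d}, r < N → σ ∈ saLoops d N →
      rotLoop N ((N - r) % N) (rotLoop N r σ) = σ := fun {r} {σ} hr hs => by
    rw [rotLoop_rotLoop (Nat.mod_lt _ hNpos),
      show (r + (N - r) % N) % N = 0 by
        rw [Nat.add_mod, Nat.mod_mod, ← Nat.add_mod, show r + (N - r) = N by omega, Nat.mod_self],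
      rotLoop_zero hs (by omega)]
  have e1 : rotLoop N ((N - r) % N) τ = orient N b ω := back hx.2 hσs
  have e2 : rotLoop N ((N - r') % N) τ = orient N b' ω' := by rw [hxx]; exact back hx'.2 hσs'
  have hrr : (N - r) % N = (N - r') % N :=
    rot_eq_of_canon hτ (by omega) (Nat.mod_lt _ hNpos) (Nat.mod_lt _ hNpos) (e1 ▸ hσ) (e2 ▸ hσ')
  have hr_eq : r = r' := by
    have h1 := hx.2; have h2 := hx'.2
    rcases Nat.eq_zero_or_pos r with hr0 | hr0 <;> rcases Nat.eq_zero_or_pos r' with hr0' | hr0'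
    · omega
    · rw [hr0, Nat.sub_zero, Nat.mod_self, Nat.mod_eq_of_lt (by omega : N - r' < N)] at hrr; omega
    · rw [hr0', Nat.sub_zero, Nat.mod_self, Nat.mod_eq_of_lt (by omega : N - r < N)] at hrr; omega
    · rw [Nat.mod_eq_of_lt (by omega : N - r < N), Nat.mod_eq_of_lt (by omega : N - r' < N)] at hrr; omega
  subst hr_eq
  have hoo : orient N b ω = orient N b' ω' := by rw [← e1, ← e2]
  have hωs := (mem_canonLoops.1 hω).1
  have hωs' := (mem_canonLoops.1 hω').1
  have key : b = b' ∧ ω = ω' := by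
    cases b <;> cases b'
    · exact ⟨rfl, by simpa [orient] using hoo⟩
    · exfalso
      have hoo' : ω = revLoop N ω' := by simpa [orient] using hoo
      have h1 : ω 1 = ω' (N - 1) := by rw [hoo', revLoop_of_le (by omega)]
      have h2 : ω (N - 1) = ω' 1 := by rw [hoo', revLoop_of_le (by omega), show N - (N - 1) = 1 by omega]
      rw [h1, h2] at hlt
      exact lt_asymm hlt hlt'
    · exfalso
      have hoo' : revLoop N ω = ω' := by simpa [orient] using hoo
      have h1 : ω' 1 = ω (N - 1) := by rw [← hoo', revLoop_of_le (by omega)]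
      have h2 : ω' (N - 1) = ω 1 := by rw [← hoo', revLoop_of_le (by omega), show N - (N - 1) = 1 by omega]
      rw [h1, h2] at hlt'
      exact lt_asymm hlt hlt'
    · have hoo' : revLoop N ω = revLoop N ω' := by simpa [orient] using hoo
      exact ⟨rfl, by rw [← revLoop_revLoop hωs, ← revLoop_revLoop hωs', hoo']⟩
  rw [key.2, key.1]

open Classical in
/-- **The unrooting map is onto `saLoops`** (`N ≥ 3`): re-root a loop at a lexicographically smallest site and choose the
orientation. [cite: MadrasSlade1993, §3.2, eq. (3.2.1)] -/
theorem image_unroot_eq (hN : 3 ≤ N) : (unrootDom d N).image (unroot (d := d) N) = saLoops d N := by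
  classical
  have hreps : ∀ {ω}, ω ∈ polygonReps d N → ω ∈ canonLoops d N ∧ toLex (ω 1) < toLex (ω (N - 1)) :=
    fun {ω} h => Finset.mem_filter.1 h
  apply Finset.Subset.antisymm
  · intro τ hτ
    obtain ⟨x, hx, rfl⟩ := Finset.mem_image.1 hτ
    exact unroot_mem_saLoops hx
  · intro τ hτ
    have hNpos : 0 < N := by omega
    obtain ⟨r₀, hr₀, hmin⟩ := exists_lexmin_time (N := N) (by omega) τ
    have hσ := rotLoop_mem_canonLoops hτ hr₀ hmin
    set σ := rotLoop N r₀ τ with hσdef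
    have hσs := (mem_canonLoops.1 hσ).1
    have hne : toLex (σ 1) ≠ toLex (σ (N - 1)) := fun h => by
      have := (mem_saLoops''.1 hσs).2.2.2.2 (show 1 < N by omega) (show N - 1 < N by omega) (toLex_inj.1 h)
      omega
    obtain ⟨ω₀, b, hω₀, hob⟩ : ∃ ω₀ b, ω₀ ∈ polygonReps d N ∧ orient N b ω₀ = σ := by
      rcases lt_or_gt_of_ne hne with h | h
      · exact ⟨σ, false, Finset.mem_filter.2 ⟨hσ, h⟩, by simp [orient]⟩
      · refine ⟨revLoop N σ, true, Finset.mem_filter.2 ⟨revLoop_mem_canonLoops hσ, ?_⟩, ?_⟩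
        · rw [revLoop_of_le (by omega), revLoop_of_le (by omega), show N - (N - 1) = 1 by omega]; exact h
        · simp [orient, revLoop_revLoop hσs]
    refine Finset.mem_image.2 ⟨(ω₀, (N - r₀) % N, b), ?_, ?_⟩
    · rw [mem_unrootDom]; exact ⟨hω₀, Nat.mod_lt _ hNpos⟩
    · simp only [unroot, hob, hσdef]
      rw [rotLoop_rotLoop (Nat.mod_lt _ hNpos),
        show (r₀ + (N - r₀) % N) % N = 0 by
          rw [Nat.add_mod, Nat.mod_mod, ← Nat.add_mod, show r₀ + (N - r₀) = N by omega, Nat.mod_self],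
        rotLoop_zero hτ (by omega)]

/-- **Counting a sub-family of rooted loops through the unrooting bijection**: for any decidable property `p` of loops,
`#{τ ∈ saLoops : p τ} = #{x ∈ unrootDom : p (unroot x)}` (`N ≥ 3`). [cite: MadrasSlade1993, §3.2, eq. (3.2.1)] -/
theorem card_filter_saLoops_eq (hN : 3 ≤ N) (p : (ℕ → Site d) → Prop) [DecidablePred p] :
    ((saLoops d N).filter p).card = ((unrootDom d N).filter fun x => p (unroot N x)).card := by
  classical
  rw [← image_unroot_eq hN, Finset.filter_image,
    Finset.card_image_of_injOn ((unroot_injOn hN).mono (Finset.coe_subset.2 (Finset.filter_subset _ _)))]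

end UnrootAPI

end PolygonConcat

end Literature.Probability.RandomPlanarGeometry.SAW.Zd
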